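import Summits.QuantumFields.YangMills.Theorems.BalabanUVNodesK0Stub1SectFWSlotAtRecordSocket
import Summits.QuantumFields.YangMills.Theorems.BalabanUVNodesK0Stub1SectFWSlotAtRecordFlatChart
import Summits.QuantumFields.YangMills.Theorems.BalabanUVNodesK0Stub1FlatChartDTransposeLetterAtRecordHerm0
import Summits.QuantumFields.YangMills.Theorems.BalabanUVNodesK0Stub1TransposeNeumannLetter
import HarnessLib

/-!
# K0⁷ STUB 1 (`stub_prop8StepCoP13` ∕ V20-G `stub_prop8StepCoPG13`), sub-target S4b «the (δ∕δA′)V pieces at objects» — **C‴: THE ♭ W-SLOT OF [15] (157)–(158) AT THE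
# RECORD IN THE IMPLICIT ♭ CHART `Dsel♭`, WITH THE REALITY OF THE CHART DISPLAYED** — this seat's C″ `…SectFWSlotAtRecordFlatScaled` (p633312,
# `exists_sectF_W_atRecord_flatScaled`) RE-THREADED over dag-k0-s1-w4's herm0 edition of the implicit ♭ chart at the record
# (`…K0Stub1FlatChartDTransposeLetterAtRecordHerm0.exists_chartDFlat_himp_herm0_T4`, CLAIM-8 = this seat's ASK «LOCATED-REALITY-THREAD», bus 2026-08-28 13:44Z): the
# statement is C″'s VERBATIM plus ONE displayed conjunct «for every Hermitian-traceless `A′` in the `ε`-ball, `Dsel A′` and the dressed field `A′ − H(Dsel A′)` are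
# Hermitian-traceless»

Cell `pub-ymgap`, width seat `pub-ymgap-k0-s1-w2` g6 (CLAIM-2, bus 2026-08-28 ≈14:00Z).  `--kind proof --supports stmt-QuantumFields-20541 --as helper`; count-neutral;
def-free.  [15] = [Balaban1985Variational]; [B7] = [Balaban1985Averaging]; [B6] = [Balaban1984PropagatorsII].

WHY.  The (127)∕(128) junction on the ♭ road (dag-k0-s1-w1 FILE 5's stationarity ∘ this seat's `…K0Stub1Eq157FlatScaledS1` §3 ∘ the (157) certificate) and this seat's
`K0Stub1RealityFromCertificate.herm_of_certificate` both read the charted curve `e^{iη(A′ − H♭Dsel♭A′)}` in `SU(N)` and the (157) functional through its REAL part — they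
need `Dsel♭A′` Hermitian-traceless for Hermitian-traceless `A′`.  C″∕D″ display, for their ∃-bound `Dsel`, only (55)♭ with an ∃-bound constant, `ContDiffOn ℂ ω` and
(49)♭∕(48)♭, from which reality is NOT recoverable (dag-k0-s1-w4's engines p633473∕p634823∕p635684 need the `4C₂♭ε²` ball bound on the whole ball; the value `CD = 4C₂♭` is
hidden by `∃ CD`).  dag-k0-s1-w4 therefore displayed the herm0 conclusion AT THE SOURCE (CLAIM-8, `chartDFlat_valued_herm0` inside `exists_chartDFlat_himp_T4`'s proof,
winding guard discharged by shrinking `ε`); THIS FILE carries that conjunct through C″'s assembly unchanged — every other line is C″'s.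

WHAT IS PROVED (sorry-free; no definition; axioms standard).
* ★★★★ `exists_sectF_W_atRecord_flatScaled_herm0` — C″'s `exists_sectF_W_atRecord_flatScaled` VERBATIM (for every `F : T4Family`, `N ≥ 1`, `Mρ₀ ≥ 0`, `O₁ ≥ 0`:
  `∃ Mh₀ R₀, h₀ ≥ 0, ε > 0, C_D Θ₀ ≥ 0` such that at every admissible nested family of the record's four-tori, the (152) weights, EVERY `ℂ`-linear `H` with the ♭ kernel, the
  fibre letters, the pairings `BE`, `B` and EVERY `B`-symmetric `MV` with the unit-weight row sum `O₁`: the implicit ♭ chart `Dsel` with (55)♭, `ContDiffOn ℂ ω`, (49)♭,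
  (48)♭ on the `ε`-ball) **∧ «`∀ A′` in the `ε`-ball, `(∀ b, A′ b ∈ herm0) → (∀ i, Dsel A′ i ∈ herm0) ∧ ∀ b, (A′ − H(Dsel A′)) b ∈ herm0`»**, then as in C″: transposes
  `Qt, Ht, Dt A′`, the site chart `e`, the map `W` with (157)'s `HasFDerivAt`, `DifferentiableOn ℂ W`, and the (158) row with the same constant `C₄`.
HONEST SCOPE.  `exact` re-assembly of C″ over CLAIM-8; nothing of [15] Sects. D–F or [B7] asserted beyond the engines cited BY NAME; the measure-level identification of the
record's constraint with the ♭ functional ((92)∕(97)∕(99)) is dag-k0-s1-w1's fibre-dictionary lane (p632255∕p637359∕FILE 5) and is NOT asserted here; `stub_prop8StepCoP13` ∕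
`stub_prop8StepCoPG13` ∕ K0⁷ NOT closed; N07 NOT discharged; no summit statement is proved by this seat; counts unmoved (28∕28 · 5∕27); one finite 𝕋⁴ programme at
fixed ε — R4 closes the conditional finite-𝕋⁴ rung `BalabanLadder.UV` only, never the summit; the YM mass gap (Clay) is NOT proved by any of this; nothing continuum ∕ ℝ⁴
∕ OS.  No `sorry`, no `def`, no `instance`, no `notation`.

References: [15] (27) p.282, (44)–(50) p.285, (55) p.286, (72)–(73) p.289, (80) p.290, (88) p.291, Prop. 4 (97)–(98) pp.292–293, (152) p.301, (157)–(158) p.302; [B7]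
Prop. 5 (157) p.42; [B6] (2.2)–(2.4) p.224, (2.35) p.228, Cor. 2.8 p.249, (3.132); [Balaban1987RG1] (0.1) p.251, (0.4) p.253.
-/

set_option autoImplicit false

noncomputable section

open scoped BigOperators Matrix.Norms.L2Operator Topology ContDiff

namespace Summit.QuantumFields.YangMills.Theorems.K0Stub1SectFWSlotAtRecordFlatScaledHerm0

open Literature.MathematicalPhysics.QuantumFieldTheory.Balaban1983to89
open Literature.MathematicalPhysics.QuantumFieldTheory.Balaban1983to89.T4Continuum (T4Family)
open B6SectADomainsV1 (Domains)
open B6SectAOperatorsV1 (BondIdx)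
open B9Eq39Adjoint (bondPair)
open B11Eq26ActionExpansion (V0)
open B4Sect5Torus (TSite)
open Summit.QuantumFields.YangMills.Theorems.FlatCubeOpsText (Adm22)
open Summit.QuantumFields.YangMills.Theorems.K0FlatCubeOpsTextP (IsLevWeight flatH)
open Summit.QuantumFields.YangMills.Theorems.Prop8ChartDoubleBar (chartLogFlat)
open Summit.QuantumFields.YangMills.Theorems.K0Stub1SectFWSlotAtRecordSocket (exists_sectF_W_atRecord_of_chartSocket)
open Summit.QuantumFields.YangMills.Theorems.K0Stub1SectFWSlotAtRecordFlatChart (nonempty_bondIdx)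
open Summit.QuantumFields.YangMills.Theorems.K0Stub1FlatChartQlinLetters (hQ_chartLogFlat_of_adm22 hQt'_chartLogFlat_unitWeight_T4)
open B9AdOrthogonal (herm0)
open Summit.QuantumFields.YangMills.Theorems.K0Stub1FlatChartDTransposeLetterAtRecord (hHt_flat_T4)
open Summit.QuantumFields.YangMills.Theorems.K0Stub1FlatChartDTransposeLetterAtRecordHerm0 (exists_chartDFlat_himp_herm0_T4)
open Summit.QuantumFields.YangMills.Theorems.K0Stub1TransposeNeumannLetter (h73t_of_implicit_transposes)

/-- ★★★★ **C‴ — THE ♭ W-SLOT OF [15] (157)–(158) AT THE RECORD IN THE IMPLICIT ♭ CHART, WITH THE REALITY OF THE CHART DISPLAYED** (see the module docstring):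
C″ p633312 VERBATIM plus the conjunct «Hermitian-traceless `A′` in the `ε`-ball ⇒ `Dsel A′` and `A′ − H(Dsel A′)` Hermitian-traceless», threaded from dag-k0-s1-w4's
`exists_chartDFlat_himp_herm0_T4`; every constant (`ε` apart, only smaller) and every other line as in C″.
[cite: Balaban1985Variational, (27) p.282, (44)-(50) p.285, (55) p.286, (72)-(73) p.289, (80) p.290, (88) p.291, Prop. 4 (97)-(98) pp.292-293, (152) p.301, (157)-(158) p.302; Balaban1985Averaging, Prop. 5 (157) p.42; Balaban1984PropagatorsII, Cor. 2.8 p.249; Balaban1987RG1, (0.1) p.251, (0.4) p.253] -/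
theorem exists_sectF_W_atRecord_flatScaled_herm0 (N : ℕ) [NeZero N] (F : T4Family) (Mρ₀ O₁ : ℝ) (hMρ₀ : 0 ≤ Mρ₀) (hO₁ : 0 ≤ O₁) :
    ∃ (Mh₀ R₀ : ℕ) (h₀ ε CD Θ₀ : ℝ), 0 ≤ h₀ ∧ 0 < ε ∧ 0 ≤ CD ∧ 0 ≤ Θ₀ ∧
    ∀ (n K : ℕ) (_ : 1 ≤ K - n) (_ : K - n + 1 ≤ F.m + K) {Mh R a' : ℕ} (_ : Mh = F.L ^ a') (_ : Mh₀ ≤ Mh) (_ : R₀ ≤ R)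
      (_ : a' + 3 ≤ F.m + n) (D : Domains (F.P K)) (hDk : D.k = K - n) (_ : Adm22 D R (F.L * Mh))
      [Fact ((0 : ℝ) < ((F.P K).L : ℝ))] [Fact ((0 : ℝ) < (((F.P K).L : ℝ))⁻¹ ^ (K - n))]
    {w : ℕ → PBond (F.P K) 0 → ℝ} (hw : IsLevWeight (F.P K) (K - n) D w)
    -- the ♭ right inverse: ANY ℂ-linear map with the kernel `(L^{j(t)}η)⁻¹·(flatH e_t)(b)`
    (H : (BondIdx D → Matrix (Fin N) (Fin N) ℂ) →ₗ[ℂ] (PBond (F.P K) 0 → Matrix (Fin N) (Fin N) ℂ))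
    (hH : ∀ (X : BondIdx D → Matrix (Fin N) (Fin N) ℂ) (b : PBond (F.P K) 0), H X b =
      ∑ t, (((((F.P K).L : ℝ) ^ (t.1.1 : ℕ) * ((((F.P K).L : ℝ))⁻¹) ^ (K - n))⁻¹ * flatH (F.P K) (K - n) D (Pi.single t 1) b : ℝ) : ℂ) • X t)
    -- the fibre letters and the pairings
    (τ : Matrix (Fin N) (Fin N) ℂ →L[ℂ] ℂ) (ρ : (Matrix (Fin N) (Fin N) ℂ →L[ℂ] ℂ) →L[ℂ] Matrix (Fin N) (Fin N) ℂ)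
    (hρ : ∀ (ℓ' : Matrix (Fin N) (Fin N) ℂ →L[ℂ] ℂ) (X : Matrix (Fin N) (Fin N) ℂ), τ (ρ ℓ' * X) = ℓ' X)
    (hτ : ∀ a b : Matrix (Fin N) (Fin N) ℂ, τ (a * b) = τ (b * a)) (hτs : ∀ a : Matrix (Fin N) (Fin N) ℂ, τ (star a) = starRingEnd ℂ (τ a))
    (hτ1 : ∀ X : Matrix (Fin N) (Fin N) ℂ, ‖τ X‖ ≤ ‖X‖) {Mρ : ℝ} (hMρ : 0 ≤ Mρ) (hMρle : Mρ ≤ Mρ₀) (hρn : ∀ ℓ' : Matrix (Fin N) (Fin N) ℂ →L[ℂ] ℂ, ‖ρ ℓ'‖ ≤ Mρ * ‖ℓ'‖)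
    (BE : (PBond (F.P K) 0 → Matrix (Fin N) (Fin N) ℂ) →L[ℂ] (PBond (F.P K) 0 → Matrix (Fin N) (Fin N) ℂ) →L[ℂ] ℂ)
    (hBE : ∀ Y δ : PBond (F.P K) 0 → Matrix (Fin N) (Fin N) ℂ, BE Y δ =
      bondPair ((((F.P K).L : ℝ))⁻¹ ^ (K - n)) (F.P K).d (τ : Matrix (Fin N) (Fin N) ℂ →ₗ[ℂ] ℂ) (fun μ x => Y ⟨x, μ⟩) (fun μ x => δ ⟨x, μ⟩))
    (B : (BondIdx D → Matrix (Fin N) (Fin N) ℂ) →L[ℂ] (BondIdx D → Matrix (Fin N) (Fin N) ℂ) →L[ℂ] ℂ)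
    (hB : ∀ X X' : BondIdx D → Matrix (Fin N) (Fin N) ℂ, B X X' = ∑ t, τ (X t * X' t)) (hBsymm : ∀ a b, B a b = B b a)
    -- ANY `B`-symmetric multiplier with a unit-weight (3.132) row sum `O₁` (instance of record: `M♭ = λ⁻¹η^d(E − a)λ⁻¹`)
    (MV : (BondIdx D → Matrix (Fin N) (Fin N) ℂ) →L[ℂ] (BondIdx D → Matrix (Fin N) (Fin N) ℂ)) (hMsym : ∀ a b, B (MV a) b = B a (MV b))
    (h3132 : ∀ (X : BondIdx D → Matrix (Fin N) (Fin N) ℂ) (s : ℝ), (∀ i, (1 : ℝ) * ‖X i‖ ≤ s) → ∀ i, (1 : ℝ) * ‖MV X i‖ ≤ O₁ * s),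
    -- the implicit ♭ chart of record and its letters on the `ε`-ball
    ∃ Dsel : (PBond (F.P K) 0 → Matrix (Fin N) (Fin N) ℂ) → (BondIdx D → Matrix (Fin N) (Fin N) ℂ),
      (∀ A' : PBond (F.P K) 0 → Matrix (Fin N) (Fin N) ℂ, (∀ b, w 1 b * ‖A' b‖ < ε) →
        ∀ ρ' : ℝ, 0 ≤ ρ' → (∀ b, w 1 b * ‖A' b‖ ≤ ρ') → ∀ i : BondIdx D, ‖Dsel A' i‖ ≤ CD * ρ' ^ 2) ∧
      ContDiffOn ℂ ω Dsel {Y : PBond (F.P K) 0 → Matrix (Fin N) (Fin N) ℂ | ∀ b, w 1 b * ‖Y b‖ < ε} ∧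
      (∀ A' : PBond (F.P K) 0 → Matrix (Fin N) (Fin N) ℂ, (∀ b, w 1 b * ‖A' b‖ < ε) →
        chartLogFlat (((((F.P K).L : ℝ))⁻¹) ^ (K - n)) D (A' - H (Dsel A')) - (fderiv ℂ (chartLogFlat (((((F.P K).L : ℝ))⁻¹) ^ (K - n)) D :
        (PBond (F.P K) 0 → Matrix (Fin N) (Fin N) ℂ) → BondIdx D → Matrix (Fin N) (Fin N) ℂ) 0) (A' - H (Dsel A')) = Dsel A' ∧
        chartLogFlat (((((F.P K).L : ℝ))⁻¹) ^ (K - n)) D (A' - H (Dsel A')) = (fderiv ℂ (chartLogFlat (((((F.P K).L : ℝ))⁻¹) ^ (K - n)) D :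
        (PBond (F.P K) 0 → Matrix (Fin N) (Fin N) ℂ) → BondIdx D → Matrix (Fin N) (Fin N) ℂ) 0) A') ∧
      (∀ A' : PBond (F.P K) 0 → Matrix (Fin N) (Fin N) ℂ, (∀ b, w 1 b * ‖A' b‖ < ε) → (∀ b, A' b ∈ herm0 (Fin N)) →
        (∀ i, Dsel A' i ∈ herm0 (Fin N)) ∧ ∀ b, (A' - H (Dsel A')) b ∈ herm0 (Fin N)) ∧
    ∃ (Qt : (BondIdx D → Matrix (Fin N) (Fin N) ℂ) →L[ℂ] (PBond (F.P K) 0 → Matrix (Fin N) (Fin N) ℂ)) (Ht : (PBond (F.P K) 0 → Matrix (Fin N) (Fin N) ℂ) →L[ℂ] (BondIdx D → Matrix (Fin N) (Fin N) ℂ))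
      (Dt : (PBond (F.P K) 0 → Matrix (Fin N) (Fin N) ℂ) → ((BondIdx D → Matrix (Fin N) (Fin N) ℂ) →L[ℂ] (PBond (F.P K) 0 → Matrix (Fin N) (Fin N) ℂ))),
      (∀ X δ, BE (Qt X) δ = B X ((fderiv ℂ (chartLogFlat (((((F.P K).L : ℝ))⁻¹) ^ (K - n)) D :
        (PBond (F.P K) 0 → Matrix (Fin N) (Fin N) ℂ) → BondIdx D → Matrix (Fin N) (Fin N) ℂ) 0) δ)) ∧
      (∀ Z X, BE Z (H X) = B (Ht Z) X) ∧
      (∀ (A' : PBond (F.P K) 0 → Matrix (Fin N) (Fin N) ℂ) X δ, BE (Dt A' X) δ = B X (fderiv ℂ Dsel A' δ)) ∧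
      ∃ (e : Site (F.P K) 0 ≃ TSite (F.P K).d (fun _ => (F.P K).sitesPerDir 0)) (W : (PBond (F.P K) 0 → Matrix (Fin N) (Fin N) ℂ) → (PBond (F.P K) 0 → Matrix (Fin N) (Fin N) ℂ)),
          (∀ (x : Site (F.P K) 0) (μ : Fin (F.P K).d), e (x.shift μ) = B9SectCLatticeCarrier.shift μ (e x)) ∧
          (∀ A' : PBond (F.P K) 0 → Matrix (Fin N) (Fin N) ℂ, (∀ b, w 1 b * ‖A' b‖ < ε) →
            (∀ (b : PBond (F.P K) 0) (ν : Fin (F.P K).d), w 2 b * ((F.P K).L : ℝ) ^ (K - n) * ‖A' ⟨b.src.shift ν, b.dir⟩ - A' b‖ < ε) →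
            HasFDerivAt (fun A : PBond (F.P K) 0 → Matrix (Fin N) (Fin N) ℂ => 2⁻¹ * B (Dsel A) (MV (Dsel A)) - B ((fderiv ℂ (chartLogFlat (((((F.P K).L : ℝ))⁻¹) ^ (K - n)) D :
        (PBond (F.P K) 0 → Matrix (Fin N) (Fin N) ℂ) → BondIdx D → Matrix (Fin N) (Fin N) ℂ) 0) A) (MV (Dsel A))
                + V0 (LatticeFieldCalculus.shiftEquiv (P := F.P K) (j := 0)) (fun _ _ => (1 : (Matrix (Fin N) (Fin N) ℂ)ˣ)) ((((F.P K).L : ℝ)⁻¹) ^ (K - n)) (F.P K).d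
                    (τ : Matrix (Fin N) (Fin N) ℂ →ₗ[ℂ] ℂ) (fun μ x => (A - H (Dsel A)) ⟨x, μ⟩))
              (BE (W A')) A') ∧
          DifferentiableOn ℂ W {Y : PBond (F.P K) 0 → Matrix (Fin N) (Fin N) ℂ | (∀ b, w 1 b * ‖Y b‖ < ε) ∧
            ∀ (b : PBond (F.P K) 0) (ν : Fin (F.P K).d), w 2 b * ((F.P K).L : ℝ) ^ (K - n) * ‖Y ⟨b.src.shift ν, b.dir⟩ - Y b‖ < ε} ∧
          (∀ (Y : PBond (F.P K) 0 → Matrix (Fin N) (Fin N) ℂ) (r : ℝ), r < ε → (∀ b, w 1 b * ‖Y b‖ ≤ r) →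
            (∀ (b : PBond (F.P K) 0) (ν : Fin (F.P K).d), w 2 b * ((F.P K).L : ℝ) ^ (K - n) * ‖Y ⟨b.src.shift ν, b.dir⟩ - Y b‖ ≤ r) →
            ∀ b, w 3 b * ‖W Y b‖ ≤
              ((Θ₀ * Mρ) * O₁ * (CD * ε + ((F.P K).L : ℝ)) + 2 * O₁ * CD
                + (1 + (Θ₀ * Mρ) * ε * h₀) * ((((F.P K).d - 1 : ℕ) : ℝ) * (((F.P K).L : ℝ) ^ 2) ^ 3 * Mρ * (200 + 2 * ((F.P K).L : ℝ) ^ 2)) * (2 : ℝ) ^ 2)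
                * r ^ 2) := by
  classical
  obtain ⟨Mh₂, R₂, Bf, εD, CD, Θ, hBf, hεD, hCD, hΘ, hD⟩ := exists_chartDFlat_himp_herm0_T4 N F
  obtain ⟨Mh₃, R₃, h₀, hh₀, hHtl⟩ := hHt_flat_T4 N F
  -- the radius: inside (β2)'s window, small for `ℓ := 2`, and inside the Neumann window for every `M_ρ ≤ Mρ₀`
  have hBC : 0 < 1 + Bf * CD := by have := mul_nonneg hBf hCD; linarith
  have hNw : 0 < 4 * h₀ * Θ * Mρ₀ + 1 := by have := mul_nonneg (mul_nonneg (mul_nonneg (by norm_num : (0:ℝ) ≤ 4) hh₀) hΘ) hMρ₀; linarith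
  set ε : ℝ := min εD (min (1 / (32 * (1 + Bf * CD))) (1 / (4 * h₀ * Θ * Mρ₀ + 1))) with hεdef
  have hε0 : 0 < ε := by rw [hεdef]; exact lt_min hεD (lt_min (by positivity) (by positivity))
  have hεD' : ε ≤ εD := min_le_left _ _
  have hεB : ε ≤ 1 / (32 * (1 + Bf * CD)) := (min_le_right _ _).trans (min_le_left _ _)
  have hεN : ε ≤ 1 / (4 * h₀ * Θ * Mρ₀ + 1) := (min_le_right _ _).trans (min_le_right _ _)
  have hε32 : ε ≤ 1 / 32 := by
    refine hεB.trans ?_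
    rw [div_le_div_iff₀ (by positivity) (by norm_num)]
    nlinarith [mul_nonneg hBf hCD]
  have hℓ1 : 1 + Bf * CD * ε ≤ 2 := by
    have h1 : Bf * CD * ε ≤ Bf * CD * (1 / (32 * (1 + Bf * CD))) := mul_le_mul_of_nonneg_left hεB (mul_nonneg hBf hCD)
    have h2 : Bf * CD * (1 / (32 * (1 + Bf * CD))) ≤ 1 := by
      rw [mul_one_div, div_le_one (by positivity)]; nlinarith [mul_nonneg hBf hCD]
    linarith
  have hℓ2 : 2 * ε ≤ 1 / 16 := by linarith
  refine ⟨max Mh₂ Mh₃, max (max R₂ R₃) 2, h₀, ε, CD, 2 * Θ, hh₀, hε0, hCD, by positivity, ?_⟩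
  intro n K hk1 hk' Mh R a' hMha hMh hR hsize D hDk hAdm _ _ w hw H hH τ ρ hρ hτ hτs hτ1 Mρ hMρ hMρle hρn BE hBE B hB hBsymm MV hMsym h3132
  have hMh₂ : Mh₂ ≤ Mh := le_trans (le_max_left _ _) hMh
  have hMh₃ : Mh₃ ≤ Mh := le_trans (le_max_right _ _) hMh
  have hR₂ : R₂ ≤ R := le_trans (le_trans (le_max_left _ _) (le_max_left _ _)) hR
  have hR₃ : R₃ ≤ R := le_trans (le_trans (le_max_right _ _) (le_max_left _ _)) hR
  have hR2 : 2 ≤ R := le_trans (le_max_right _ _) hR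
  have hL0 : (0 : ℝ) < ((F.P K).L : ℝ) := by exact_mod_cast (F.P K).L_pos
  have hη : ((((F.P K).L : ℝ))⁻¹ ^ (K - n)) ≠ 0 := by positivity
  have hw1 : ∀ b, 0 ≤ w 1 b := fun b => by rw [hw 1 b]; positivity
  have hd : 4 ≤ (F.P K).d := le_of_eq (T4Family.P_d F K).symm
  have hMh1 : 1 ≤ Mh := by rw [hMha]; exact Nat.one_le_pow _ _ (F.P K).L_pos
  have hRM1 : 1 ≤ R * (F.L * Mh) := Nat.mul_pos (by omega) (Nat.mul_pos (F.P K).L_pos (by omega))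
  have hRM2 : 2 * (F.P K).L ≤ R * (F.L * Mh) := by
    have hPL : (F.P K).L = F.L := rfl
    rw [hPL]
    calc 2 * F.L ≤ R * (F.L * 1) := by rw [mul_one]; exact Nat.mul_le_mul_right _ hR2
      _ ≤ R * (F.L * Mh) := Nat.mul_le_mul_left _ (Nat.mul_le_mul_left _ hMh1)
  haveI : Nonempty (BondIdx D) := nonempty_bondIdx D (by omega)
  obtain ⟨i₀⟩ := (inferInstance : Nonempty (BondIdx D))
  -- the kernel hypothesis of `H` at an ARBITRARY `DecidableEq (BondIdx D)` instance of `Pi.single` (instances form a subsingleton; the cited files may elaborate another one)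
  have hHgen : ∀ (d : DecidableEq (BondIdx D)) (X : BondIdx D → Matrix (Fin N) (Fin N) ℂ) (b : PBond (F.P K) 0), H X b =
      ∑ t, (((((F.P K).L : ℝ) ^ (t.1.1 : ℕ) * ((((F.P K).L : ℝ))⁻¹) ^ (K - n))⁻¹ *
        flatH (F.P K) (K - n) D (@Pi.single (BondIdx D) (fun _ => ℝ) _ d t 1) b : ℝ) : ℂ) • X t := by
    intro d X b
    rw [hH X b]
    exact Finset.sum_congr rfl fun t _ =>
      congrArg (fun v : BondIdx D → ℝ => (((((F.P K).L : ℝ) ^ (t.1.1 : ℕ) * ((((F.P K).L : ℝ))⁻¹) ^ (K - n))⁻¹ * flatH (F.P K) (K - n) D v b : ℝ) : ℂ) • X t)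
        (congrArg (fun inst : DecidableEq (BondIdx D) => @Pi.single (BondIdx D) (fun _ => ℝ) _ inst t (1 : ℝ)) (Subsingleton.elim _ _))
  -- (α)∕(β2): rows of `H`, the implicit ♭ chart with the Socket shape, (49)♭∕(48)♭ and the `himp` socket
  obtain ⟨hHB, hHgrad, -, Dsel, h55, hcd, hfix, hherm, himp⟩ := hD n K hk1 hk' hMha hMh₂ hR₂ hsize D hDk hAdm w hw H (hHgen _)
  have h55' : ∀ A' : PBond (F.P K) 0 → Matrix (Fin N) (Fin N) ℂ, (∀ b, w 1 b * ‖A' b‖ < ε) →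
      ∀ ρ' : ℝ, 0 ≤ ρ' → (∀ b, w 1 b * ‖A' b‖ ≤ ρ') → ∀ i : BondIdx D, ‖Dsel A' i‖ ≤ CD * ρ' ^ 2 :=
    fun A' hA' ρ' hρ' hle i => h55 A' (fun b => (hA' b).trans_le hεD') ρ' hρ' hle i
  have hcd' : ContDiffOn ℂ ω Dsel {Y : PBond (F.P K) 0 → Matrix (Fin N) (Fin N) ℂ | ∀ b, w 1 b * ‖Y b‖ < ε} :=
    hcd.mono fun Y hY b => (hY b).trans_le hεD'
  have hfix' : ∀ A' : PBond (F.P K) 0 → Matrix (Fin N) (Fin N) ℂ, (∀ b, w 1 b * ‖A' b‖ < ε) →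
      chartLogFlat (((((F.P K).L : ℝ))⁻¹) ^ (K - n)) D (A' - H (Dsel A')) - (fderiv ℂ (chartLogFlat (((((F.P K).L : ℝ))⁻¹) ^ (K - n)) D :
        (PBond (F.P K) 0 → Matrix (Fin N) (Fin N) ℂ) → BondIdx D → Matrix (Fin N) (Fin N) ℂ) 0) (A' - H (Dsel A')) = Dsel A' ∧
      chartLogFlat (((((F.P K).L : ℝ))⁻¹) ^ (K - n)) D (A' - H (Dsel A')) = (fderiv ℂ (chartLogFlat (((((F.P K).L : ℝ))⁻¹) ^ (K - n)) D :
        (PBond (F.P K) 0 → Matrix (Fin N) (Fin N) ℂ) → BondIdx D → Matrix (Fin N) (Fin N) ℂ) 0) A' :=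
    fun A' hA' => hfix A' fun b => (hA' b).trans_le hεD'
  have hherm' : ∀ A' : PBond (F.P K) 0 → Matrix (Fin N) (Fin N) ℂ, (∀ b, w 1 b * ‖A' b‖ < ε) → (∀ b, A' b ∈ herm0 (Fin N)) →
      (∀ i, Dsel A' i ∈ herm0 (Fin N)) ∧ ∀ b, (A' - H (Dsel A')) b ∈ herm0 (Fin N) :=
    fun A' hA' hA'h => hherm A' (fun b => (hA' b).trans_le hεD') hA'h
  -- the generic Socket (p621022) at `(Q, H, Dfun) := (Qlin♭, H♭, Dsel♭)`
  obtain ⟨Qt, Ht, Dt, hQt, hHt, hDt, main⟩ :=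
    exists_sectF_W_atRecord_of_chartSocket N (F.P K) hd (K - n) hRM1 D hAdm hw H hBf hHB hBf hHgrad hε0 hCD Dsel h55' hcd'
      τ ρ hρ hτ hτs hτ1 hMρ hρn BE hBE B hB hBsymm MV hMsym (fderiv ℂ (chartLogFlat (((((F.P K).L : ℝ))⁻¹) ^ (K - n)) D :
        (PBond (F.P K) 0 → Matrix (Fin N) (Fin N) ℂ) → BondIdx D → Matrix (Fin N) (Fin N) ℂ) 0)
  -- the letters at unit block weight: `q₀ = 2`, `q = L` (p621264), `h₀` ((β2b)), `θ₀ = 2Θ·M_ρ` ((β1) ∘ (β2b))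
  have hQt' : ∀ (X : BondIdx D → Matrix (Fin N) (Fin N) ℂ) (s : ℝ), (∀ i, (fun _ : BondIdx D => (1 : ℝ)) i * ‖X i‖ ≤ s) →
      ∀ b, w 3 b * ‖Qt X b‖ ≤ 2 * s := by
    intro X s hX b
    have hs : 0 ≤ s := le_trans (by rw [one_mul]; exact norm_nonneg _) (hX i₀)
    exact hQt'_chartLogFlat_unitWeight_T4 F n K D hDk hw τ ρ hρ hτ BE hBE B hB Qt hQt X s hs hX b
  have hQ : ∀ (A' : PBond (F.P K) 0 → Matrix (Fin N) (Fin N) ℂ) (r : ℝ), (∀ b, w 1 b * ‖A' b‖ ≤ r) →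
      ∀ i, (1 : ℝ) * ‖(fderiv ℂ (chartLogFlat (((((F.P K).L : ℝ))⁻¹) ^ (K - n)) D :
        (PBond (F.P K) 0 → Matrix (Fin N) (Fin N) ℂ) → BondIdx D → Matrix (Fin N) (Fin N) ℂ) 0) A' i‖ ≤ ((F.P K).L : ℝ) * r :=
    fun A' r hA' i => hQ_chartLogFlat_of_adm22 (K - n) D hDk hAdm hRM2 hw A' r hA' i
  have h46t : ∀ (Z : PBond (F.P K) 0 → Matrix (Fin N) (Fin N) ℂ) (s' : ℝ), (∀ b, w 3 b * ‖Z b‖ ≤ s') →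
      ∀ t, (fun _ : BondIdx D => (1 : ℝ)) t * ‖Ht Z t‖ ≤ h₀ * s' :=
    fun Z s' hZ t => hHtl n K hk1 hk' hMha hMh₃ hR₃ hsize D hDk hAdm hw H (hHgen _) τ ρ hρ hτ BE hBE B hB Ht hHt Z s' hZ t
  have hsmall : 2 * h₀ * (Θ * Mρ) * ε ≤ 1 := by
    have h1 : 2 * h₀ * (Θ * Mρ) * ε ≤ 2 * h₀ * (Θ * Mρ₀) * (1 / (4 * h₀ * Θ * Mρ₀ + 1)) :=
      mul_le_mul (mul_le_mul_of_nonneg_left (mul_le_mul_of_nonneg_left hMρle hΘ) (by positivity)) hεN hε0.le (by positivity)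
    have h2 : 2 * h₀ * (Θ * Mρ₀) * (1 / (4 * h₀ * Θ * Mρ₀ + 1)) ≤ 1 := by
      rw [mul_one_div, div_le_one hNw]; nlinarith [mul_nonneg (mul_nonneg hh₀ hΘ) hMρ₀]
    exact h1.trans h2
  have himp' : ∀ (A' : PBond (F.P K) 0 → Matrix (Fin N) (Fin N) ℂ) (r : ℝ), (∀ b, w 1 b * ‖A' b‖ ≤ r) →
      (∀ (b : PBond (F.P K) 0) (ν : Fin (F.P K).d), w 2 b * ((F.P K).L : ℝ) ^ (K - n) * ‖A' ⟨b.src.shift ν, b.dir⟩ - A' b‖ ≤ r) → r < ε →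
      ∃ (C' : (PBond (F.P K) 0 → Matrix (Fin N) (Fin N) ℂ) →L[ℂ] (BondIdx D → Matrix (Fin N) (Fin N) ℂ)) (Ct : (BondIdx D → Matrix (Fin N) (Fin N) ℂ) →L[ℂ] (PBond (F.P K) 0 → Matrix (Fin N) (Fin N) ℂ)),
        (∀ δ, fderiv ℂ Dsel A' δ = C' (δ - H (fderiv ℂ Dsel A' δ))) ∧ (∀ X δ, BE (Ct X) δ = B X (C' δ)) ∧
        ∀ (X : BondIdx D → Matrix (Fin N) (Fin N) ℂ) (s : ℝ), (∀ t, (fun _ : BondIdx D => (1 : ℝ)) t * ‖X t‖ ≤ s) → ∀ b, w 3 b * ‖Ct X b‖ ≤ (Θ * Mρ) * r * s :=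
    fun A' r h0 h1 hr => himp τ ρ hρ hτ hτ1 hMρ hρn BE hBE B hB A' r h0 h1 (hr.trans_le hεD')
  have h73t : ∀ (A' : PBond (F.P K) 0 → Matrix (Fin N) (Fin N) ℂ) (r : ℝ), (∀ b, w 1 b * ‖A' b‖ ≤ r) →
      (∀ (b : PBond (F.P K) 0) (ν : Fin (F.P K).d), w 2 b * ((F.P K).L : ℝ) ^ (K - n) * ‖A' ⟨b.src.shift ν, b.dir⟩ - A' b‖ ≤ r) → r < ε →
      ∀ (X : BondIdx D → Matrix (Fin N) (Fin N) ℂ) (s : ℝ), (∀ i, (fun _ : BondIdx D => (1 : ℝ)) i * ‖X i‖ ≤ s) →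
        ∀ b, w 3 b * ‖Dt A' X b‖ ≤ ((2 * Θ) * Mρ) * r * s := by
    intro A' r h0 h1 hr X s hX b
    have h := h73t_of_implicit_transposes (K - n) D w hw1 τ ρ hρ hτ hη BE hBE B Dsel H Ht hHt (fun _ => (1 : ℝ)) (fun _ => one_pos)
      (mul_nonneg hΘ hMρ) hh₀ h46t hsmall himp' Dt hDt A' r h0 h1 hr X s hX b
    calc w 3 b * ‖Dt A' X b‖ ≤ (2 * (Θ * Mρ)) * r * s := h
      _ = ((2 * Θ) * Mρ) * r * s := by ring
  have h3132' : ∀ (X : BondIdx D → Matrix (Fin N) (Fin N) ℂ) (s : ℝ), (∀ i, (1 : ℝ) * ‖X i‖ ≤ s) →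
      ∀ i, (fun _ : BondIdx D => (1 : ℝ)) i * ‖MV X i‖ ≤ O₁ * s := fun X s hX i => h3132 X s hX i
  obtain ⟨e, W, he, h157, hdiff, h158⟩ :=
    main (fun _ => (1 : ℝ)) O₁ 2 ((2 * Θ) * Mρ) h₀ 2 ((F.P K).L : ℝ) hO₁ (by positivity) hh₀ hℓ1 hℓ1 hℓ2 h3132' hQt' h73t h46t hQ
  exact ⟨Dsel, h55', hcd', hfix', hherm', Qt, Ht, Dt, hQt, hHt, hDt, e, W, he, h157, hdiff, h158⟩

end Summit.QuantumFields.YangMills.Theorems.K0Stub1SectFWSlotAtRecordFlatScaledHerm0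

end
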